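import Literature.MathematicalPhysics.QuantumFieldTheory.Balaban1983to89.T4TermwiseCurrency
import Literature.MathematicalPhysics.QuantumFieldTheory.Balaban1983to89.T4BoundaryCarrier

/-!
# T⁴ continuum, node U5 (NE7), TERM-WISE member — THE OTHER KINDS RESOLVED: the boundary kind rate-matched along the
# tower, the one-sided and constant kinds merged, the centring (O′) asked of the RESIDUAL kind only

Lineage t4-ne7-p1 (term-wise matching modulo constants), generation 6.  HONEST FRAMING (page 1): pure YM₄ on a FIXED
FINITE torus T⁴, rung (B)+1 of the cell's ladder = the `ε → 0` limit of expectations of gauge-invariant observables; NOT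
infinite volume, NOT a mass gap, NOT the Clay problem.  Spine estimate NE7 (node U5: for every `K` a `t`-independent
constant `c_K` with `|log Z^B_{K+1}(t) − log Z^A_K(t) − c_K| ≤ δ_K·|T₁|`, `Σ_K δ_K < ∞`) is NOT PRINTED for Bałaban's
d = 4 procedure; its d = 2, 3 template is [King1986] (3.10)–(3.13) pp. 656–657 (TEMPLATE ONLY).  Every estimate below is
a HYPOTHESIS BINDER named in the statement; nothing of Bałaban's expansions is asserted; no conditional (BetaPertH, (B),
(B^μ)) is hidden — they sit by name inside the producers of the binders exactly where those modules declare them.  All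
declarations are [folklore] bookkeeping (composition of tree theorems).  NO definitions, no cite tags.

## Why this leaf (record `t4/T4-EST-NE7-P1.md` v5.2 §9 (9c): the wall of the term-wise route is the binder (O′))
Generations 2–5 composed node U3's three brackets along the tower for the E-GROUP of the (2.25)-format (the factors
`exp(E^{(j)}(g, U_K(v), X) − E^{(j)}(g, 1, X))`, LOCATION p. 259 of [Balaban1988Convergent]) and discharged that group's
share of hazard H-U5b-1 at the reference witness (`T4TermwiseDeviation`, `T4TermwiseCurrency`).  Everything ELSE in a
term — the boundary pieces `𝐁^{(j)}(X; g, U_k, A|_X)` of (2.40)–(2.42) p. 261 / `𝐁′^{(k)}(X)` of (1.98)–(1.101) p. 390 of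
[Balaban1989LargeFieldII], run B's unmatched ultraviolet step, the vacuum-energy counterterms, the large-field /
R-operation normalisations — was ONE opaque pair of factors `o^A`, `o^B` with two binders: (O) a log-ratio radius
`RO ≤ vol·rO_K`, `Σ rO < ∞`, about a centre `cO_K(t,τ)`, and (O′) the centring `|cO_K(t,τ) − c₀_K| ≤ vol·s_K`,
`Σ s < ∞` — the honest location of all that is left of H-U5b-1, NOT PRINTED.  This leaf opens the pair `o^A`, `o^B` into
FOUR GROUPS and treats three of them by kernel, IN TECHNIQUE ("δ_K from NE2–NE5's rates composed along the tower,
summability from the geometric factors"):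
* the BOUNDARY group becomes the SECOND RATE-MATCHED KIND: node U3.B's boundary shapes (`T4BoundaryCarrier.NE9Fl`,
  `LipBackgroundFl`, `NE5B` — cell NE5/NE9 for boundary pieces, NOT PRINTED; the carrier freezes the pending fluctuation
  field `b = A|_X`, identified between the runs, header (c) of that module, and lets the restricted large-field data
  `{S_i ∩ X}` of (2.41) ride with the domain index `X`, header (d)) are COMPOSED ALONG THE TOWER exactly as the
  E-group was in generation 2 (`T4TowerRateDischarge.uRateUpTo_tower_anyRate`): the Lipschitz table `CU` of
  `LipBackgroundFl` is `b`-free, so the argument bracket is composed ONCE (`argBracket_tower`) and the three brackets are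
  summed per admissible `b` — OUTPUT `URateUpTo K (atFl BA b) (atFl BB b) …` with ONE constant for all `b ∈ admFl` and all
  cutoffs (§1).  Consequence (§2): in a good term of the hybrid split, whose boundary pieces are born in the log window
  `[jlog_{Cl}(K), K]` (print, LOCATION: the scale-`j` boundary pieces of (2.41) p. 261 are summed over `X ∈ 𝒟_j` with
  `X ∩ Ω_j ≠ ∅` AND `X ∩ Z_j ≠ ∅`, `Z_j` the large-field region, p. 258 — «B_k includes various expressions localized
  closely to large field regions», p. 259; a good term of the hybrid split has no large-field region below the window), the
  boundary group's log-ratio is CENTRED AT ZERO — boundary pieces carry no vacuum-energy subtraction — within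
  `E₀′·(Cw·vol)·windowSum θ′ Λ (jlogOf Cl K) K`, summable in `K` for EVERY `θ′ < 1` (`T4GoodClassBudget.sum_rate_le_windowSum`,
  `summable_windowSum_log`, pv16's window machinery BY NAME).  So the boundary kind has NO share in (O′);
* the ONE-SIDED groups (pieces without a partner in the other run — run B's unmatched ultraviolet step is the OLDEST slice,
  smallest by one-run size) enter by SIZE about the centre ZERO: binders `|log n^A| ≤ vol·z^A_K`, `|log n^B| ≤ vol·z^B_K`,
  `Σ z < ∞` (NOT PRINTED as typed; located at the first summand of (2.43) p. 263) — NO share in (O′);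
* the CONSTANT groups (positive, datum- and `t`-free: the `t`-free vacuum-energy counterterms) shift the class constant by
  the EXACT amount `log q^B_K − log q^A_K` — NO share in (O′) and no estimate at all;
* the RESIDUAL group keeps (O)+(O′) under the names (R)(R′): R-operation / large-field normalisations, the
  `−β_j(g_{j−1})A` counter-term booking (record §9 note I2), any `t`- or `τ`-DEPENDENT normalisation.  THIS is the wall of
  the term-wise route after generation 6, stated as the binders `hR hRR hrR hdevR` of §5.
The merge is pure algebra (§3 `kinds_merge_pointwise`): centres add, radii add, the constant shift cancels in (O′)
(`centre_shift_sub`).  Generation 5's capstones are then RE-KEYED (§4 one term family, any currency; §5 all strings of a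
scheme, given the two rate families, and END TO END on the t-currency towers from the sibling nodes' typed outputs).

## What this module adds (additive leaf; imports `T4TermwiseCurrency` (gen 5) and `T4BoundaryCarrier` (row T4-U3.B)
## BY NAME; nothing upstream is edited)
§1 `uRateUpToFl_of_tables`, `uRateUpToFl_of_nodesT` — the boundary tower, any currency and the t-currency instance.
§2 `boundaryGroup_logRatio_le`, `boundaryRadius_le_windowSum`, `boundaryKind_O`, `summable_boundaryRadius` — the
   boundary kind of one term: centre `0`, radius `E₀′·(Cw·vol)·windowSum`, summable.  This is the `URateUpTo`-keyed
   sibling of pv16's `T4GoodClassBudget.boundary_log_prod_le` (keyed by `BoundaryRate` = `FactorLogRatio` at the recent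
   profile, fed at ONE cutoff by `T4BoundaryCarrier.uRateFl_of_u3B` / `factorLogRatio_boundary`, whose geometric bracket
   bounds `ha₁`, `hb₁` are INPUTS there); the same window machinery BY NAME.  What is new in this leaf is §1 — those
   bracket bounds PRODUCED along the tower with ONE constant for all cutoffs — and the re-keying §4–§5.
§3 `kinds_merge_pointwise`, `centre_shift_sub` — the kind ledger (algebra).
§4 `goodClause_summable_of_kinds_witness` — generation 5's `goodClause_summable_of_rate_witness` with (O)(O′) replaced by
   (B-T)(B-adm)(B-win)(M-B)(N)(Q)(R)(R′); explicit `δ′_K`, `Summable δ′`.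
§5 `hasContinuumLimit_of_kinds_rate_witness` (given the E-rate and boundary-rate families) and
   `hasContinuumLimit_of_kinds_nodesT` (end to end from the nodes, t-currency): node U0's three targets
   `HasContinuumLimit Sc ∧ HasUniqueLimitPoints Sc ∧ LimitPointsAgree Sc`.
§6 `toy_kinds_nonvacuous` — the new binders of §2–§3 jointly inhabited on the one-point boundary carrier with the two
   runs' boundary pieces DIFFERENT and nonzero (`BA ≡ 1`, `BB ≡ 1/2`), rate family, window and multiplicity holding, the
   merge applied: the produced radius `1/2·windowSum θ Λ 0 0 = 1/2` is attained by the genuine log-ratio.  No physics.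

## Binder census of `hasContinuumLimit_of_kinds_nodesT` (every one a hypothesis; which are estimates)
(T) E-tower, string-independent, NOT PRINTED as two-run statements: `h9 hΛm hUL hG h5` on `Wt`, `hloc hgd`, `hinj` (node
U2's output; on the analytic member its producer's hypotheses carry the BetaPertH-type input), `htA htB`, signs, the rate
window.  (B-T) boundary tower, string-independent, NOT PRINTED: `h9B hΛB hULB hGB h5B` on `WB`, `htAB htBB`, `max(ωB,θc) <
θ′`, `θ₅B ≤ θ′`.  (F) format `hfmtA hfmtB hint hsc hoff` with the four groups written out (STRUCTURAL; LOCATION (2.25)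
p. 259, (2.40) p. 261).  (F′) `hwit`.  (S) `hS hSle`.  (M) `hM`, (M-B) `hMB`.  (B-adm) `hpend`: the pending field of a good
term's datum is admissible (STRUCTURAL; the A-argument's printed domain, (3.43) p. 276 — a LOCATION).  (B-win) `hBwin`:
boundary pieces of a good term are recent, `RecentOnly … (jlogOf Cl K) K` (STRUCTURAL, the hybrid split).  (N) `hnpos hzA
hzB hzAs hzBs` one-sided sizes (NOT PRINTED as typed).  (Q) `hq`.  (R) `hrpos hR hRR hrR` residual radii, (R′) `hdevR`
residual centring — NOT PRINTED: THE WALL.  (W) `hW` `RelWeightBound` (NOT PRINTED; sibling seats).  (L1-pos) `hA hB`.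
(E1/E2) `hZA hZB`.  OUTPUT: node U0's three targets.

## What is NOT delivered
Any producer of (T), (B-T)'s shapes, (N), (R), (R′), (W); the identification of the two runs' pending fields beyond
`T4BoundaryCarrier`'s recorded convention; anything about print.  The boundary kind's t-currency Lipschitz growth
`PolyLipGrowth CUB (1/g_K²) PB qB′` is a binder like its E-sibling (cell GAPS G-t4-U3-2).

References (LOCATIONS / TEMPLATE only; nothing here is cited as proving a binder): [King1986] C. King, The U(1) Higgs
model: I. The continuum limit, Commun. Math. Phys. 102 (1986) 649–677, (3.10)–(3.13) pp. 656–657 (template of NE7);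
[Balaban1988Convergent] T. Bałaban, Convergent renormalization expansions for lattice gauge theories, Commun. Math. Phys.
119 (1988) 243–285, (2.25) p. 259, (2.40)–(2.43) pp. 261–263, (3.43) p. 276 (locations of the one-run shapes);
[Balaban1989LargeFieldII] T. Bałaban, Large field renormalization. II. Localization, exponentiation, and bounds for the
R operation, Commun. Math. Phys. 122 (1989) 355–392, (1.98)–(1.101) p. 390 (location of the new boundary terms).
-/

open Finset MeasureTheory _root_.Filter _root_.Topology

namespace Literature.MathematicalPhysics.QuantumFieldTheory.Balaban1983to89.T4TermwiseBoundary

open T4OutputRate T4RecentScale T4GoodClassBudget T4CauchySum T4TowerRateComposition T4TowerRateDischarge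
open T4BoundaryCarrier (BFunctional atFl NE9Fl LipBackgroundFl NE5B)
open T4CurrencyMatching (invSq couplingRateT_of_injectedDisc)
open T4TermwiseCurrency

/-! ## §1 The boundary tower: node U3.B's shapes composed along the tower, uniformly in the admissible pending field -/

section Tower

open T4EtaRateMin (Readings LocalRate)
open T4RateLiaison (GaugeDominated)

variable {C : T4BoundaryCarrier.Carriers} {ι X : Type}

/-- **THE BOUNDARY KIND ALONG THE TOWER, ANY CURRENCY (K-uniform constant, uniform in the admissible pending field).**
Node U3.B's shapes for the two runs' boundary-piece functionals `BA`, `BB` on a window `W` of histories — `NE9Fl BA W κ Λ`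
with `FadingMemory C₉ ω Λ`, `LipBackgroundFl BA W κ CU` (ONE Lipschitz table `CU`, independent of the pending field) with
`PolyLipGrowth CU gA P q` along run A's tables, `NE5B BA BB W κ θ₅ C₅` (all NOT PRINTED: `T4BoundaryCarrier` §2) —, node
U1b/NE3 as `LocalRate R C₃ θ₃` (`θ₃ < 1`) with the liaison `GaugeDominated R uA uB`, both runs' tables in `W`, and an
abstract coupling rate `|gA K i − gB K i| ≤ D·θc^i` (`i ≤ K`).  Conclusion: for ANY `θ′ > max(ω, θc)` with `θ₅, θ₃ ≤ θ′`
ONE `a ≥ 0` such that FOR EVERY ADMISSIBLE PENDING FIELD `b` AND EVERY CUTOFF `K` the node-U3 rate `URateUpTo K` holds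
between the frozen functionals `atFl BA b`, `atFl BB b` with constant `a + C₉·D·θ′/(θ′ − max(ω,θc)) + C₅` and rate `θ′`
— the argument bracket is composed ONCE (`argBracket_tower`, the table `CU` being `b`-free), the three brackets per `b`
(`uRateUpTo_tower_anyRate`).  The boundary analogue of `T4TermwiseCurrency.uRateUpTo_of_tables`. [folklore] -/
theorem uRateUpToFl_of_tables {R : Readings ι X} {W : Set (ℕ → ℝ)} {BA : BFunctional C C.BgA} {BB : BFunctional C C.BgB}
    {κ θ₅ C₅ C₉ ω θc D C₃ θ₃ P θ' : ℝ} {q : ℕ} {Λ : ℕ → ℕ → ℝ} {CU : (ℕ → ℝ) → ℕ → ℝ} {gA gB : ℕ → ℕ → ℝ}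
    {uA : ℕ → ι → C.BgA} {uB : ℕ → ι → C.BgB}
    (h9 : NE9Fl BA W κ Λ) (hΛ : FadingMemory C₉ ω Λ) (hω : 0 ≤ ω)
    (hU : LipBackgroundFl BA W κ CU) (hG : PolyLipGrowth CU gA P q) (hP : 0 ≤ P)
    (h5 : NE5B BA BB W κ θ₅ C₅) (hθ₅ : 0 ≤ θ₅) (hC₅ : 0 ≤ C₅)
    (hloc : LocalRate R C₃ θ₃) (hC₃ : 0 ≤ C₃) (hθ₃ : 0 ≤ θ₃) (hθ₃1 : θ₃ < 1) (hgd : GaugeDominated R uA uB)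
    (hcoup : ∀ K i, i ≤ K → |gA K i - gB K i| ≤ D * θc ^ i) (hD : 0 ≤ D) (hθc : 0 ≤ θc)
    (hgA : ∀ K, gA K ∈ W) (hgB : ∀ K, gB K ∈ W)
    (hθ' : max ω θc < θ') (hθ₅' : θ₅ ≤ θ') (hθ₃' : θ₃ ≤ θ') :
    ∃ a : ℝ, 0 ≤ a ∧ ∀ b ∈ C.admFl, ∀ K, URateUpTo K (atFl BA b) (atFl BB b) (gA K) (gB K) (uA K) (uB K) R.dom
      (a + C₉ * D * (θ' / (θ' - max ω θc)) + C₅) θ' κ := by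
  have hclose := closeness_of_localRate (C := C.toCarriers) hloc hgd
  obtain ⟨a, ha0, harg⟩ := argBracket_tower (δc := fun K => C₃ * θ₃ ^ K) hG hP hC₃ hθ₃ hθ₃1 hθ₃'
    (fun K => by positivity) (fun K => le_rfl)
  refine ⟨a, ha0, fun b hb K => ?_⟩
  exact uRateUpTo_tower_anyRate (Adm := fun _ => R.dom) (δc := fun K => C₃ * θ₃ ^ K) (h9 b hb) hΛ (hU b hb) (h5 b hb)
    hω hθc hθ₅ (hθ₃.trans hθ₃') hC₅ hD ha0 hθ' hθ₅' le_rfl hgA hgB hcoup hclose (fun K j hj => (hG K j hj).1) harg K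

/-- **THE t-CURRENCY INSTANCE OF THE BOUNDARY TOWER**: the shapes read on a t-window `Wt` for boundary functionals of the
t-history, the Lipschitz growth along run A's t-tables `i ↦ 1/g_K(i)²`, NE3 + liaison, both runs' t-tables in `Wt`, and
node U2's NATIVE output `InjectedRate Cd 0 θc (disc g_K g_{K+1})` consumed with constant `Cd`
(`T4CurrencyMatching.couplingRateT_of_injectedDisc`; no box binder). [folklore] -/
theorem uRateUpToFl_of_nodesT {R : Readings ι X} {Wt : Set (ℕ → ℝ)} {BA : BFunctional C C.BgA}
    {BB : BFunctional C C.BgB} {κ θ₅ C₅ C₉ ω θc Cd C₃ θ₃ P θ' : ℝ} {q : ℕ} {Λ : ℕ → ℕ → ℝ}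
    {CU : (ℕ → ℝ) → ℕ → ℝ} {g : ℕ → ℕ → ℝ} {uA : ℕ → ι → C.BgA} {uB : ℕ → ι → C.BgB}
    (h9 : NE9Fl BA Wt κ Λ) (hΛ : FadingMemory C₉ ω Λ) (hω : 0 ≤ ω)
    (hU : LipBackgroundFl BA Wt κ CU) (hG : PolyLipGrowth CU (fun K n => invSq (g K n)) P q) (hP : 0 ≤ P)
    (h5 : NE5B BA BB Wt κ θ₅ C₅) (hθ₅ : 0 ≤ θ₅) (hC₅ : 0 ≤ C₅)
    (hloc : LocalRate R C₃ θ₃) (hC₃ : 0 ≤ C₃) (hθ₃ : 0 ≤ θ₃) (hθ₃1 : θ₃ < 1) (hgd : GaugeDominated R uA uB)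
    (hinj : InjectedRate Cd 0 θc (fun K j => T4CouplingMatching.disc (g K) (g (K + 1)) j)) (hCd : 0 ≤ Cd)
    (hθc : 0 ≤ θc) (htA : ∀ K, (fun n => invSq (g K n)) ∈ Wt)
    (htB : ∀ K, (fun n => invSq (g (K + 1) (n + 1))) ∈ Wt)
    (hθ' : max ω θc < θ') (hθ₅' : θ₅ ≤ θ') (hθ₃' : θ₃ ≤ θ') :
    ∃ a : ℝ, 0 ≤ a ∧ ∀ b ∈ C.admFl, ∀ K, URateUpTo K (atFl BA b) (atFl BB b) (fun n => invSq (g K n))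
      (fun n => invSq (g (K + 1) (n + 1))) (uA K) (uB K) R.dom (a + C₉ * Cd * (θ' / (θ' - max ω θc)) + C₅) θ' κ :=
  uRateUpToFl_of_tables (gA := fun K n => invSq (g K n)) (gB := fun K n => invSq (g (K + 1) (n + 1))) h9 hΛ hω hU hG
    hP h5 hθ₅ hC₅ hloc hC₃ hθ₃ hθ₃1 hgd (fun K i hi => couplingRateT_of_injectedDisc hinj K i hi) hCd hθc htA htB hθ'
    hθ₅' hθ₃'

end Tower

/-! ## §2 The boundary kind of ONE term: centre ZERO, radius = the rate profile on the log window -/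

section Boundary

variable {C : T4BoundaryCarrier.Carriers} {V : Type*}

/-- The boundary group of a term is a product of exponentials, hence positive. [folklore] -/
theorem boundaryGroup_pos {Bg : Type} (B : BFunctional C Bg) (g : ℕ → ℝ) (U : Bg) (b : C.Fl) (bfac : Finset C.Dom) :
    0 < ∏ X ∈ bfac, Real.exp (B g U b X) :=
  Finset.prod_pos fun _ _ => Real.exp_pos _

/-- **THE BOUNDARY GROUP'S LOG-RATIO IS CENTRED AT ZERO WITHIN THE RATE PROFILE.**  If the node-U3 rate `URateUpTo K`
holds between the frozen functionals `atFl BA b`, `atFl BB b` for EVERY admissible pending field `b` (§1), then for a term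
whose boundary pieces `bfac` have creation scales `≤ K`, at every admissible driving datum `v` whose pending field
`pend v` is admissible, `|log ∏_{X∈bfac} e^{BB(gB, U^B(v), pend v, X)} − log ∏_{X∈bfac} e^{BA(gA, U^A(v), pend v, X)} − 0|
≤ E₀′·Σ_{X∈bfac} θ^{scale X} e^{−κ d X}` — NO centre: boundary pieces carry no vacuum-energy subtraction (they are compared
at the same pending field and the same restricted large-field data, `T4BoundaryCarrier` header (c)(d)). [folklore] -/
theorem boundaryGroup_logRatio_le {BA : BFunctional C C.BgA} {BB : BFunctional C C.BgB} {gA gB : ℕ → ℝ}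
    {uA : V → C.BgA} {uB : V → C.BgB} {Adm : Set V} {E₀' θ κ : ℝ} {K : ℕ}
    (hUR : ∀ b ∈ C.admFl, URateUpTo K (atFl BA b) (atFl BB b) gA gB uA uB Adm E₀' θ κ)
    {bfac : Finset C.Dom} (hsc : ∀ X ∈ bfac, C.scale X ≤ K) {pend : V → C.Fl} {v : V} (hv : v ∈ Adm)
    (hpend : pend v ∈ C.admFl) :
    |Real.log (∏ X ∈ bfac, Real.exp (BB gB (uB v) (pend v) X))
        - Real.log (∏ X ∈ bfac, Real.exp (BA gA (uA v) (pend v) X)) - 0|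
      ≤ E₀' * ∑ X ∈ bfac, θ ^ C.scale X * Real.exp (-(κ * C.d X)) := by
  rw [sub_zero, Real.log_prod (s := bfac) (fun _ _ => (Real.exp_pos _).ne'),
    Real.log_prod (s := bfac) (fun _ _ => (Real.exp_pos _).ne')]
  simp only [Real.log_exp]
  rw [← Finset.sum_sub_distrib, Finset.mul_sum]
  refine (Finset.abs_sum_le_sum_abs _ _).trans (Finset.sum_le_sum fun X hX => ?_)
  have h := hUR (pend v) hpend v hv X (hsc X hX)
  rw [abs_sub_comm]
  simpa [atFl, mul_assoc] using h

/-- **THE RATE PROFILE OF RECENT-ONLY BOUNDARY PIECES IS `vol ×` THE WINDOW SUM** (`T4GoodClassBudget.sum_rate_le_windowSum`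
BY NAME): boundary pieces with creation scales in the window `[j⋆, K]` and window multiplicity of the localisation weights
give `E₀′·Σ_{X∈bfac} θ^{scale X}e^{−κdX} ≤ E₀′·(Cw·vol)·windowSum θ Λ j⋆ K`. [folklore] -/
theorem boundaryRadius_le_windowSum {bfac : Finset C.Dom} {E₀' θ κ Cw vol Λ : ℝ} {jstar K : ℕ} (hE : 0 ≤ E₀')
    (hθ : 0 ≤ θ) (hrec : RecentOnly bfac C.scale jstar K)
    (hM : WindowMultiplicity bfac C.scale (fun X => Real.exp (-(κ * C.d X))) Cw vol Λ jstar K) :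
    E₀' * ∑ X ∈ bfac, θ ^ C.scale X * Real.exp (-(κ * C.d X)) ≤ E₀' * (Cw * vol) * windowSum θ Λ jstar K := by
  have h := sum_rate_le_windowSum (C := E₀') hE hθ hrec hM
  rw [Finset.mul_sum]
  refine le_trans (le_of_eq (Finset.sum_congr rfl fun X _ => ?_)) h
  ring

/-- **THE BOUNDARY KIND'S SHARE OF (O), PRODUCED**: §1's rate family + recent-only boundary pieces on the log window
`[jlog_{Cl}(K), K]` with multiplicity ⇒ at every admissible datum with admissible pending field the boundary group's
log-ratio is within `E₀′·(Cw·vol)·windowSum θ Λ (jlogOf Cl K) K` of ZERO. [folklore] -/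
theorem boundaryKind_O {BA : BFunctional C C.BgA} {BB : BFunctional C C.BgB} {gA gB : ℕ → ℝ} {uA : V → C.BgA}
    {uB : V → C.BgB} {Adm : Set V} {E₀' θ κ Cw vol Λ Cl : ℝ} {K : ℕ}
    (hUR : ∀ b ∈ C.admFl, URateUpTo K (atFl BA b) (atFl BB b) gA gB uA uB Adm E₀' θ κ) (hE : 0 ≤ E₀') (hθ : 0 ≤ θ)
    {bfac : Finset C.Dom} (hrec : RecentOnly bfac C.scale (jlogOf Cl K) K)
    (hM : Multiplicity bfac C.scale (fun X => Real.exp (-(κ * C.d X))) Cw vol Λ K) {pend : V → C.Fl} {v : V}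
    (hv : v ∈ Adm) (hpend : pend v ∈ C.admFl) :
    |Real.log (∏ X ∈ bfac, Real.exp (BB gB (uB v) (pend v) X))
        - Real.log (∏ X ∈ bfac, Real.exp (BA gA (uA v) (pend v) X)) - 0|
      ≤ E₀' * (Cw * vol) * windowSum θ Λ (jlogOf Cl K) K :=
  (boundaryGroup_logRatio_le hUR (fun X hX => (hrec X hX).2) hv hpend).trans
    (boundaryRadius_le_windowSum hE hθ hrec (windowMultiplicity_of_multiplicity hM))

/-- **THE BOUNDARY RADIUS IS SUMMABLE FOR EVERY RATE `θ < 1`** (`T4GoodClassBudget.summable_windowSum_log` BY NAME: the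
log-window sum is `poly(K)·θ^K`; no condition links `θ` and `Λ ≥ 1`). [folklore] -/
theorem summable_boundaryRadius {E₀' θ Cw Λ Cl : ℝ} (hθ0 : 0 < θ) (hθ1 : θ < 1) (hΛ : 1 ≤ Λ) (hCl : 0 ≤ Cl) :
    Summable (fun K => E₀' * Cw * windowSum θ Λ (jlogOf Cl K) K) :=
  (summable_windowSum_log hθ0 hθ1 hΛ hCl).mul_left (E₀' * Cw)

end Boundary

/-! ## §3 The kind ledger: boundary × one-sided × constant × residual, merged into the (O)/(O′) binders of the route -/

section Merge

/-- The logarithm of a product of four positive reals. [folklore] -/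
theorem log_mul_four {x y z w : ℝ} (hx : 0 < x) (hy : 0 < y) (hz : 0 < z) (hw : 0 < w) :
    Real.log (x * y * z * w) = Real.log x + Real.log y + Real.log z + Real.log w := by
  rw [Real.log_mul (by positivity) hw.ne', Real.log_mul (by positivity) hz.ne', Real.log_mul hx.ne' hy.ne']

/-- **THE KIND LEDGER OF ONE TERM AT ONE DATUM (pure algebra).**  Other-kind factors of the two runs split as
`o^A = b^A·n^A·q^A·r^A`, `o^B = b^B·n^B·q^B·r^B` (all positive): BOUNDARY groups with `|log b^B − log b^A − 0| ≤ R_b`,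
ONE-SIDED / size-booked groups with `|log n^A| ≤ Z_A`, `|log n^B| ≤ Z_B`, CONSTANT groups `q^A`, `q^B` (datum-free), and a
RESIDUAL pair with `|log r^B − log r^A − c_R| ≤ R_R`.  Then `o^A, o^B > 0` and
`|log o^B − log o^A − (c_R + (log q^B − log q^A))| ≤ R_b + (Z_A + Z_B) + R_R`: the merged CENTRE is the residual's centre
shifted by the EXACT constant `log q^B − log q^A`; boundary and one-sided groups add radius only. [folklore] -/
theorem kinds_merge_pointwise {bA bB nA nB qA qB rA rB cR RR Rb ZA ZB : ℝ} (hbA : 0 < bA) (hbB : 0 < bB)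
    (hnA : 0 < nA) (hnB : 0 < nB) (hqA : 0 < qA) (hqB : 0 < qB) (hrA : 0 < rA) (hrB : 0 < rB)
    (hb : |Real.log bB - Real.log bA - 0| ≤ Rb) (hzA : |Real.log nA| ≤ ZA) (hzB : |Real.log nB| ≤ ZB)
    (hR : |Real.log rB - Real.log rA - cR| ≤ RR) :
    0 < bA * nA * qA * rA ∧ 0 < bB * nB * qB * rB ∧
      |Real.log (bB * nB * qB * rB) - Real.log (bA * nA * qA * rA) - (cR + (Real.log qB - Real.log qA))|
        ≤ Rb + (ZA + ZB) + RR := by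
  refine ⟨by positivity, by positivity, ?_⟩
  have e : Real.log (bB * nB * qB * rB) - Real.log (bA * nA * qA * rA) - (cR + (Real.log qB - Real.log qA))
      = (Real.log bB - Real.log bA - 0) + (Real.log nB - Real.log nA) + (Real.log rB - Real.log rA - cR) := by
    rw [log_mul_four hbB hnB hqB hrB, log_mul_four hbA hnA hqA hrA]; ring
  rw [e]
  refine (abs_add_three _ _ _).trans (add_le_add (add_le_add hb ?_) hR)
  calc |Real.log nB - Real.log nA| ≤ |Real.log nB| + |Real.log nA| := abs_sub _ _
    _ ≤ ZA + ZB := by linarith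

/-- (O′) TRANSFER: the merged centre deviates from the merged class constant exactly as the residual centre deviates from
the residual class constant — the constant kind's shift cancels. [folklore] -/
theorem centre_shift_sub (cR c₀ d : ℝ) : cR + d - (c₀ + d) = cR - c₀ := by ring

end Merge

/-! ## §4 The route's capstones RE-KEYED: (O)+(O′) asked of the residual kind only -/

section Ledger

variable {C : T4BoundaryCarrier.Carriers} {ι : Type} [MeasurableSpace ι] {σ : Type*} [DecidableEq σ] {l₀ vol : ℝ}
  {T : ℕ → Finset σ} {Bad : ℕ → ℝ → Finset σ} {A B : ℕ → ℝ → σ → ℝ} {μ : ℕ → ℝ → σ → Measure ι}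
  {fac bfac : ℕ → ℝ → σ → Finset C.Dom} {Adm : Set ι} {EA : Functional C.toCarriers C.BgA}
  {EB : Functional C.toCarriers C.BgB} {BA : BFunctional C C.BgA} {BB : BFunctional C C.BgB}
  {κ θ' Cr EB₀ : ℝ} {gA gB : ℕ → ℕ → ℝ} {uA : ℕ → ι → C.BgA} {uB : ℕ → ι → C.BgB} {oneA : C.BgA} {oneB : C.BgB}
  {pend : ℕ → ℝ → σ → ι → C.Fl} {nA nB rA rB : ℕ → ℝ → σ → ι → ℝ} {qA qB : ℕ → ℝ}
  {κ₁ S : ℕ → ℝ → σ → ℕ → ℝ} {cR RR : ℕ → ℝ → σ → ℝ} {rR zA zB Wb c₀ s : ℕ → ℝ} {Cw E a Λ Cl : ℝ}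

/-- **THE GOOD-CLASS HALF WITH `Summable δ′`, THE OTHER KINDS RESOLVED.**  As
`T4TermwiseCurrency.goodClause_summable_of_rate_witness` (composed E-rate `hUR`, format (F), sizes (S), multiplicity (M),
witness (F′)), with the other-kind factors of the format SPLIT into four groups —
`o^A_K(t,τ;v) = (∏_{X∈bfac} e^{BA(gA K, U^A_K v, pend v, X)})·n^A·q^A_K·r^A`, likewise for run B — and the binders (O)(O′)
REPLACED by: (B-T) the boundary rate family `hURB` of §1 (NOT PRINTED: node U3.B's shapes composed along the tower);
(B-adm) the pending field of a good term's datum is admissible (STRUCTURAL; print: the A-argument of `𝐁^{(j)}` ranges in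
the polydisc of (3.43) p. 276 — a LOCATION); (B-win) the boundary pieces of a GOOD term are born in the log window
`[jlogOf Cl K, K]` (STRUCTURAL: by (2.41) p. 261 a scale-`j` boundary piece needs `X ∩ Z_j ≠ ∅`, and the hybrid split's
good class has no large-field region `Z_j` below the window — a LOCATION, not a citation) with multiplicity (M-B); (N) one-run SIZE bounds `|log n^A| ≤ vol·z^A_K`, `|log n^B| ≤ vol·z^B_K`, `Σ z < ∞`, for the
one-sided groups (run B's unmatched ultraviolet step = the OLDEST slice; NOT PRINTED as typed — located at the first
summand of (2.43) p. 263); (Q) positive datum-free constants `q^A_K`, `q^B_K` (t-free vacuum-energy counterterms: merged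
EXACTLY into the class constant); (R)(R′) the RESIDUAL kind's radii `RR ≤ vol·rR`, `Σ rR < ∞` and centring `|cR − c₀| ≤
vol·s`, `Σ s < ∞` — what is left of hazard H-U5b-1 after this leaf (NOT PRINTED).  OUTPUT: the good clause with the explicit
`δ′` below and `Summable δ′`. [folklore] -/
theorem goodClause_summable_of_kinds_witness
    (hUR : ∀ K, URateUpTo K EA EB (gA K) (gB K) (uA K) (uB K) Adm Cr θ' κ) (hCr : 0 ≤ Cr)
    (hθ'0 : 0 < θ') (hθ'1 : θ' < 1) (hθ'Λ : θ' ≤ Λ) (hΛ1 : 1 ≤ Λ) (hCl : 0 ≤ Cl)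
    (hURB : ∀ b ∈ C.admFl, ∀ K, URateUpTo K (atFl BA b) (atFl BB b) (gA K) (gB K) (uA K) (uB K) Adm EB₀ θ' κ)
    (hEB₀ : 0 ≤ EB₀)
    (hfmtA : ∀ K t τ, A K t τ = ∫ v, (∏ X ∈ fac K t τ,
      Real.exp (EA (gA K) (uA K v) X - EA (gA K) oneA X)) *
        ((∏ X ∈ bfac K t τ, Real.exp (BA (gA K) (uA K v) (pend K t τ v) X)) * nA K t τ v * qA K * rA K t τ v)
          ∂(μ K t τ))
    (hfmtB : ∀ K t τ, B K t τ = ∫ v, (∏ X ∈ fac K t τ,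
      Real.exp (EB (gB K) (uB K v) X - EB (gB K) oneB X)) *
        ((∏ X ∈ bfac K t τ, Real.exp (BB (gB K) (uB K v) (pend K t τ v) X)) * nB K t τ v * qB K * rB K t τ v)
          ∂(μ K t τ))
    (hint : ∀ K t, |t| ≤ l₀ → ∀ τ ∈ T K \ Bad K t,
      Integrable (fun v => (∏ X ∈ fac K t τ, Real.exp (EA (gA K) (uA K v) X - EA (gA K) oneA X)) *
        ((∏ X ∈ bfac K t τ, Real.exp (BA (gA K) (uA K v) (pend K t τ v) X)) * nA K t τ v * qA K * rA K t τ v))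
          (μ K t τ) ∧
      Integrable (fun v => (∏ X ∈ fac K t τ, Real.exp (EB (gB K) (uB K v) X - EB (gB K) oneB X)) *
        ((∏ X ∈ bfac K t τ, Real.exp (BB (gB K) (uB K v) (pend K t τ v) X)) * nB K t τ v * qB K * rB K t τ v))
          (μ K t τ))
    (hsc : ∀ K t, |t| ≤ l₀ → ∀ τ ∈ T K \ Bad K t, ∀ X ∈ fac K t τ, C.scale X ≤ K)
    (hoff : ∀ K t, |t| ≤ l₀ → ∀ τ ∈ T K \ Bad K t, ∀ v, v ∉ Adm →
      (∏ X ∈ fac K t τ, Real.exp (EA (gA K) (uA K v) X - EA (gA K) oneA X)) *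
        ((∏ X ∈ bfac K t τ, Real.exp (BA (gA K) (uA K v) (pend K t τ v) X)) * nA K t τ v * qA K * rA K t τ v)
          = 0 ∧
      (∏ X ∈ fac K t τ, Real.exp (EB (gB K) (uB K v) X - EB (gB K) oneB X)) *
        ((∏ X ∈ bfac K t τ, Real.exp (BB (gB K) (uB K v) (pend K t τ v) X)) * nB K t τ v * qB K * rB K t τ v)
          = 0)
    (hS : ∀ K t, |t| ≤ l₀ → ∀ τ ∈ T K \ Bad K t, ∀ v ∈ Adm, ∀ j ≤ K,
      |(∑ X ∈ fac K t τ with C.scale X = j,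
          (Real.log (Real.exp (EB (gB K) (uB K v) X - EB (gB K) oneB X))
            - Real.log (Real.exp (EA (gA K) (uA K v) X - EA (gA K) oneA X)))) - κ₁ K t τ j| ≤ S K t τ j)
    (hM : ∀ K t, |t| ≤ l₀ → ∀ τ ∈ T K \ Bad K t,
      Multiplicity (fac K t τ) C.scale (fun X => Real.exp (-(κ * C.d X))) Cw vol Λ K)
    (hwit : ∀ K, ∃ v₁ ∈ Adm, uA K v₁ = oneA ∧ uB K v₁ = oneB)
    (hvol : 0 ≤ vol) (hE : 0 ≤ E) (ha0 : 0 < a) (ha1 : a < 1)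
    (hSle : ∀ K t, |t| ≤ l₀ → ∀ τ ∈ T K \ Bad K t, ∀ j ≤ K, S K t τ j ≤ vol * (E * a ^ (K - j)))
    (hpend : ∀ K t, |t| ≤ l₀ → ∀ τ ∈ T K \ Bad K t, ∀ v ∈ Adm, pend K t τ v ∈ C.admFl)
    (hBwin : ∀ K t, |t| ≤ l₀ → ∀ τ ∈ T K \ Bad K t, RecentOnly (bfac K t τ) C.scale (jlogOf Cl K) K)
    (hMB : ∀ K t, |t| ≤ l₀ → ∀ τ ∈ T K \ Bad K t,
      Multiplicity (bfac K t τ) C.scale (fun X => Real.exp (-(κ * C.d X))) Cw vol Λ K)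
    (hnpos : ∀ K t, |t| ≤ l₀ → ∀ τ ∈ T K \ Bad K t, ∀ v ∈ Adm, 0 < nA K t τ v ∧ 0 < nB K t τ v)
    (hzA : ∀ K t, |t| ≤ l₀ → ∀ τ ∈ T K \ Bad K t, ∀ v ∈ Adm, |Real.log (nA K t τ v)| ≤ vol * zA K)
    (hzB : ∀ K t, |t| ≤ l₀ → ∀ τ ∈ T K \ Bad K t, ∀ v ∈ Adm, |Real.log (nB K t τ v)| ≤ vol * zB K)
    (hzAs : Summable zA) (hzBs : Summable zB)
    (hq : ∀ K, 0 < qA K ∧ 0 < qB K)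
    (hrpos : ∀ K t, |t| ≤ l₀ → ∀ τ ∈ T K \ Bad K t, ∀ v ∈ Adm, 0 < rA K t τ v ∧ 0 < rB K t τ v)
    (hR : ∀ K t, |t| ≤ l₀ → ∀ τ ∈ T K \ Bad K t, ∀ v ∈ Adm,
      |Real.log (rB K t τ v) - Real.log (rA K t τ v) - cR K t τ| ≤ RR K t τ)
    (hRR : ∀ K t, |t| ≤ l₀ → ∀ τ ∈ T K \ Bad K t, RR K t τ ≤ vol * rR K) (hrR : Summable rR)
    (hs : Summable s) (hR' : ∀ K t, |t| ≤ l₀ → ∀ τ ∈ T K \ Bad K t, |cR K t τ - c₀ K| ≤ vol * s K) :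
    GoodClause l₀ vol T A B Bad
        (fun K => (max Cw 1 * ((E + Cr) * ∑ x ∈ antidiagonal K, min (a ^ x.2) (θ' ^ x.1 * Λ ^ x.2))
            + (EB₀ * Cw * windowSum θ' Λ (jlogOf Cl K) K + (zA K + zB K) + rR K))
          + (max Cw 1 * ((E + Cr) * ∑ x ∈ antidiagonal K, min (a ^ x.2) (θ' ^ x.1 * Λ ^ x.2)) + s K)) ∧
      Summable (fun K => (max Cw 1 * ((E + Cr) * ∑ x ∈ antidiagonal K, min (a ^ x.2) (θ' ^ x.1 * Λ ^ x.2))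
            + (EB₀ * Cw * windowSum θ' Λ (jlogOf Cl K) K + (zA K + zB K) + rR K))
          + (max Cw 1 * ((E + Cr) * ∑ x ∈ antidiagonal K, min (a ^ x.2) (θ' ^ x.1 * Λ ^ x.2)) + s K)) := by
  -- the kind ledger at every good term and admissible datum (§2 boundary share + §3 merge)
  have hmerge : ∀ K t, |t| ≤ l₀ → ∀ τ ∈ T K \ Bad K t, ∀ v ∈ Adm,
      0 < (∏ X ∈ bfac K t τ, Real.exp (BA (gA K) (uA K v) (pend K t τ v) X)) * nA K t τ v * qA K * rA K t τ v ∧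
      0 < (∏ X ∈ bfac K t τ, Real.exp (BB (gB K) (uB K v) (pend K t τ v) X)) * nB K t τ v * qB K * rB K t τ v ∧
      |Real.log ((∏ X ∈ bfac K t τ, Real.exp (BB (gB K) (uB K v) (pend K t τ v) X)) * nB K t τ v * qB K
            * rB K t τ v)
          - Real.log ((∏ X ∈ bfac K t τ, Real.exp (BA (gA K) (uA K v) (pend K t τ v) X)) * nA K t τ v * qA K
            * rA K t τ v)
          - (cR K t τ + (Real.log (qB K) - Real.log (qA K)))|
        ≤ EB₀ * (Cw * vol) * windowSum θ' Λ (jlogOf Cl K) K + (vol * zA K + vol * zB K) + RR K t τ := by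
    intro K t ht τ hτ v hv
    exact kinds_merge_pointwise (boundaryGroup_pos BA (gA K) (uA K v) (pend K t τ v) (bfac K t τ))
      (boundaryGroup_pos BB (gB K) (uB K v) (pend K t τ v) (bfac K t τ)) (hnpos K t ht τ hτ v hv).1
      (hnpos K t ht τ hτ v hv).2 (hq K).1 (hq K).2 (hrpos K t ht τ hτ v hv).1 (hrpos K t ht τ hτ v hv).2
      (boundaryKind_O (fun b hb => hURB b hb K) hEB₀ hθ'0.le (hBwin K t ht τ hτ) (hMB K t ht τ hτ) hv
        (hpend K t ht τ hτ v hv))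
      (hzA K t ht τ hτ v hv) (hzB K t ht τ hτ v hv) (hR K t ht τ hτ v hv)
  have hrO : Summable (fun K => EB₀ * Cw * windowSum θ' Λ (jlogOf Cl K) K + (zA K + zB K) + rR K) :=
    ((summable_boundaryRadius hθ'0 hθ'1 hΛ1 hCl).add (hzAs.add hzBs)).add hrR
  refine goodClause_summable_of_rate_witness
    (oA := fun K t τ v => (∏ X ∈ bfac K t τ, Real.exp (BA (gA K) (uA K v) (pend K t τ v) X)) * nA K t τ v * qA K
      * rA K t τ v)
    (oB := fun K t τ v => (∏ X ∈ bfac K t τ, Real.exp (BB (gB K) (uB K v) (pend K t τ v) X)) * nB K t τ v * qB K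
      * rB K t τ v)
    (cO := fun K t τ => cR K t τ + (Real.log (qB K) - Real.log (qA K)))
    (RO := fun K t τ => EB₀ * (Cw * vol) * windowSum θ' Λ (jlogOf Cl K) K + (vol * zA K + vol * zB K) + RR K t τ)
    (c₀ := fun K => c₀ K + (Real.log (qB K) - Real.log (qA K)))
    hUR hCr hθ'0 hθ'1 hθ'Λ hfmtA hfmtB hint hsc (fun K t ht τ hτ v hv => ⟨(hmerge K t ht τ hτ v hv).1,
      (hmerge K t ht τ hτ v hv).2.1⟩) hoff hS hM hwit (fun K t ht τ hτ v hv => (hmerge K t ht τ hτ v hv).2.2) hvol hE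
    ha0 ha1 hSle (fun K t ht τ hτ => ?_) hrO hs (fun K t ht τ hτ => ?_)
  · show EB₀ * (Cw * vol) * windowSum θ' Λ (jlogOf Cl K) K + (vol * zA K + vol * zB K) + RR K t τ
        ≤ vol * (EB₀ * Cw * windowSum θ' Λ (jlogOf Cl K) K + (zA K + zB K) + rR K)
    have h1 := hRR K t ht τ hτ
    have e : vol * (EB₀ * Cw * windowSum θ' Λ (jlogOf Cl K) K + (zA K + zB K) + rR K)
        = EB₀ * (Cw * vol) * windowSum θ' Λ (jlogOf Cl K) K + (vol * zA K + vol * zB K) + vol * rR K := by ring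
    rw [e]; linarith
  · show |cR K t τ + (Real.log (qB K) - Real.log (qA K)) - (c₀ K + (Real.log (qB K) - Real.log (qA K)))| ≤ vol * s K
    rw [centre_shift_sub]; exact hR' K t ht τ hτ

end Ledger

/-! ## §5 All strings of a scheme: the node-U0 targets with the other kinds resolved -/

section Scheme

open Missing T4Continuum T4Assembly
open T4EtaRateMin (Readings LocalRate)
open T4RateLiaison (GaugeDominated)

variable {G : Type*} [GaugeGroup G] [MeasurableSpace G] [HaarData G] {O : Type*}

variable {C : T4BoundaryCarrier.Carriers} {ι X : Type} [MeasurableSpace ι] {Adm : Set ι}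
  {EA : Functional C.toCarriers C.BgA} {EB : Functional C.toCarriers C.BgB} {BA : BFunctional C C.BgA}
  {BB : BFunctional C C.BgB} {κ θ' Cr EB₀ : ℝ} {gA gB : ℕ → ℕ → ℝ} {uA : ℕ → ι → C.BgA} {uB : ℕ → ι → C.BgB}
  {oneA : C.BgA} {oneB : C.BgB} {Cw E a Λ Cl : ℝ}

/-- **ALL STRINGS, GIVEN THE TWO RATE FAMILIES — the term-wise route's capstone with the other kinds resolved.**  As
`T4TermwiseCurrency.hasContinuumLimit_of_rate_witness` (string-independent composed E-rate `hUR`, witness (F′), per-string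
(F)(S)(M)(W)(L1-pos)(E1/E2)), with the string-independent BOUNDARY rate family `hURB` (§1; NOT PRINTED) and, per string,
the other-kind factors split into boundary × one-sided × constant × residual groups: (B-adm)(B-win)(M-B) for the boundary
group, (N) one-run sizes with summable rates for the one-sided groups, (Q) positive datum-free constants, and (R)(R′) radii
and centring FOR THE RESIDUAL KIND ONLY.  CONCLUSION: node U0's three targets.  HONEST FRAMING: fixed finite torus, rung
(B)+1, CONDITIONAL on every binder named — NE7 (both halves) NOT PRINTED; nothing here is infinite volume, a mass gap, or
the Clay problem. [folklore] -/
theorem hasContinuumLimit_of_kinds_rate_witness [RegularGaugeGroup G] {σ : List O → Type} [∀ os, DecidableEq (σ os)]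
    {l₀ : ℝ} {vol : List O → ℝ} {K₀ : List O → ℕ} {T : (os : List O) → ℕ → Finset (σ os)}
    {Bad : (os : List O) → ℕ → ℝ → Finset (σ os)} {A B : (os : List O) → ℕ → ℝ → σ os → ℝ}
    {μ : (os : List O) → ℕ → ℝ → σ os → Measure ι} {fac bfac : (os : List O) → ℕ → ℝ → σ os → Finset C.Dom}
    {pend : (os : List O) → ℕ → ℝ → σ os → ι → C.Fl} {nA nB rA rB : (os : List O) → ℕ → ℝ → σ os → ι → ℝ}
    {qA qB : List O → ℕ → ℝ} {κ₁ S : (os : List O) → ℕ → ℝ → σ os → ℕ → ℝ}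
    {cR RR : (os : List O) → ℕ → ℝ → σ os → ℝ} {rR zA zB Wb : List O → ℕ → ℝ}
    (Sc : TorusScheme G O) (hβ : ∀ K, 0 ≤ Sc.β K) (hm : ∀ K o, Measurable (Sc.obs K o))
    (h1 : ∀ K o U, |Sc.obs K o U| ≤ 1) (hl₀ : 0 < l₀)
    (hUR : ∀ K, URateUpTo K EA EB (gA K) (gB K) (uA K) (uB K) Adm Cr θ' κ) (hCr : 0 ≤ Cr)
    (hθ'0 : 0 < θ') (hθ'1 : θ' < 1) (hθ'Λ : θ' ≤ Λ) (hΛ1 : 1 ≤ Λ) (hCl : 0 ≤ Cl) (hE : 0 ≤ E) (ha0 : 0 < a)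
    (ha1 : a < 1)
    (hURB : ∀ b ∈ C.admFl, ∀ K, URateUpTo K (atFl BA b) (atFl BB b) (gA K) (gB K) (uA K) (uB K) Adm EB₀ θ' κ)
    (hEB₀ : 0 ≤ EB₀)
    (hwit : ∀ K, ∃ v₁ ∈ Adm, uA K v₁ = oneA ∧ uB K v₁ = oneB)
    (hvol : ∀ os, 0 < vol os)
    (hfmtA : ∀ os K t τ, A os K t τ = ∫ v, (∏ X ∈ fac os K t τ,
      Real.exp (EA (gA K) (uA K v) X - EA (gA K) oneA X)) *
        ((∏ X ∈ bfac os K t τ, Real.exp (BA (gA K) (uA K v) (pend os K t τ v) X)) * nA os K t τ v * qA os K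
          * rA os K t τ v) ∂(μ os K t τ))
    (hfmtB : ∀ os K t τ, B os K t τ = ∫ v, (∏ X ∈ fac os K t τ,
      Real.exp (EB (gB K) (uB K v) X - EB (gB K) oneB X)) *
        ((∏ X ∈ bfac os K t τ, Real.exp (BB (gB K) (uB K v) (pend os K t τ v) X)) * nB os K t τ v * qB os K
          * rB os K t τ v) ∂(μ os K t τ))
    (hint : ∀ os K t, |t| ≤ l₀ → ∀ τ ∈ T os K \ Bad os K t,
      Integrable (fun v => (∏ X ∈ fac os K t τ, Real.exp (EA (gA K) (uA K v) X - EA (gA K) oneA X)) *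
        ((∏ X ∈ bfac os K t τ, Real.exp (BA (gA K) (uA K v) (pend os K t τ v) X)) * nA os K t τ v * qA os K
          * rA os K t τ v)) (μ os K t τ) ∧
      Integrable (fun v => (∏ X ∈ fac os K t τ, Real.exp (EB (gB K) (uB K v) X - EB (gB K) oneB X)) *
        ((∏ X ∈ bfac os K t τ, Real.exp (BB (gB K) (uB K v) (pend os K t τ v) X)) * nB os K t τ v * qB os K
          * rB os K t τ v)) (μ os K t τ))
    (hsc : ∀ os K t, |t| ≤ l₀ → ∀ τ ∈ T os K \ Bad os K t, ∀ X ∈ fac os K t τ, C.scale X ≤ K)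
    (hoff : ∀ os K t, |t| ≤ l₀ → ∀ τ ∈ T os K \ Bad os K t, ∀ v, v ∉ Adm →
      (∏ X ∈ fac os K t τ, Real.exp (EA (gA K) (uA K v) X - EA (gA K) oneA X)) *
        ((∏ X ∈ bfac os K t τ, Real.exp (BA (gA K) (uA K v) (pend os K t τ v) X)) * nA os K t τ v * qA os K
          * rA os K t τ v) = 0 ∧
      (∏ X ∈ fac os K t τ, Real.exp (EB (gB K) (uB K v) X - EB (gB K) oneB X)) *
        ((∏ X ∈ bfac os K t τ, Real.exp (BB (gB K) (uB K v) (pend os K t τ v) X)) * nB os K t τ v * qB os K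
          * rB os K t τ v) = 0)
    (hS : ∀ os K t, |t| ≤ l₀ → ∀ τ ∈ T os K \ Bad os K t, ∀ v ∈ Adm, ∀ j ≤ K,
      |(∑ X ∈ fac os K t τ with C.scale X = j,
          (Real.log (Real.exp (EB (gB K) (uB K v) X - EB (gB K) oneB X))
            - Real.log (Real.exp (EA (gA K) (uA K v) X - EA (gA K) oneA X)))) - κ₁ os K t τ j| ≤ S os K t τ j)
    (hM : ∀ os K t, |t| ≤ l₀ → ∀ τ ∈ T os K \ Bad os K t,
      Multiplicity (fac os K t τ) C.scale (fun X => Real.exp (-(κ * C.d X))) Cw (vol os) Λ K)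
    (hSle : ∀ os K t, |t| ≤ l₀ → ∀ τ ∈ T os K \ Bad os K t, ∀ j ≤ K,
      S os K t τ j ≤ vol os * (E * a ^ (K - j)))
    (hpend : ∀ os K t, |t| ≤ l₀ → ∀ τ ∈ T os K \ Bad os K t, ∀ v ∈ Adm, pend os K t τ v ∈ C.admFl)
    (hBwin : ∀ os K t, |t| ≤ l₀ → ∀ τ ∈ T os K \ Bad os K t, RecentOnly (bfac os K t τ) C.scale (jlogOf Cl K) K)
    (hMB : ∀ os K t, |t| ≤ l₀ → ∀ τ ∈ T os K \ Bad os K t,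
      Multiplicity (bfac os K t τ) C.scale (fun X => Real.exp (-(κ * C.d X))) Cw (vol os) Λ K)
    (hnpos : ∀ os K t, |t| ≤ l₀ → ∀ τ ∈ T os K \ Bad os K t, ∀ v ∈ Adm, 0 < nA os K t τ v ∧ 0 < nB os K t τ v)
    (hzA : ∀ os K t, |t| ≤ l₀ → ∀ τ ∈ T os K \ Bad os K t, ∀ v ∈ Adm,
      |Real.log (nA os K t τ v)| ≤ vol os * zA os K)
    (hzB : ∀ os K t, |t| ≤ l₀ → ∀ τ ∈ T os K \ Bad os K t, ∀ v ∈ Adm,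
      |Real.log (nB os K t τ v)| ≤ vol os * zB os K)
    (hzAs : ∀ os, Summable (zA os)) (hzBs : ∀ os, Summable (zB os))
    (hq : ∀ os K, 0 < qA os K ∧ 0 < qB os K)
    (hrpos : ∀ os K t, |t| ≤ l₀ → ∀ τ ∈ T os K \ Bad os K t, ∀ v ∈ Adm, 0 < rA os K t τ v ∧ 0 < rB os K t τ v)
    (hR : ∀ os K t, |t| ≤ l₀ → ∀ τ ∈ T os K \ Bad os K t, ∀ v ∈ Adm,
      |Real.log (rB os K t τ v) - Real.log (rA os K t τ v) - cR os K t τ| ≤ RR os K t τ)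
    (hRR : ∀ os K t, |t| ≤ l₀ → ∀ τ ∈ T os K \ Bad os K t, RR os K t τ ≤ vol os * rR os K)
    (hrR : ∀ os, Summable (rR os))
    (hdevR : ∀ os, ∃ c₀ s : ℕ → ℝ, Summable s ∧
      ∀ K t, |t| ≤ l₀ → ∀ τ ∈ T os K \ Bad os K t, |cR os K t τ - c₀ K| ≤ vol os * s K)
    (hW : ∀ os, T4WeightBudget.RelWeightBound l₀ (T os) (A os) (B os) (Bad os) (Wb os))
    (hA : ∀ os K t, |t| ≤ l₀ → ∀ τ ∈ T os K, 0 ≤ A os K t τ)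
    (hB : ∀ os K t, |t| ≤ l₀ → ∀ τ ∈ T os K, 0 ≤ B os K t τ)
    (hZA : ∀ os K t, |t| ≤ l₀ → T4GenFunBounds.schemeZ Sc os (K₀ os + K) t = ∑ τ ∈ T os K, A os K t τ)
    (hZB : ∀ os K t, |t| ≤ l₀ → T4GenFunBounds.schemeZ Sc os (K₀ os + K + 1) t = ∑ τ ∈ T os K, B os K t τ) :
    HasContinuumLimit Sc ∧ HasUniqueLimitPoints Sc ∧ LimitPointsAgree Sc := by
  -- the kind ledger per string, good term and admissible datum (§2 + §3)
  have hmerge : ∀ os K t, |t| ≤ l₀ → ∀ τ ∈ T os K \ Bad os K t, ∀ v ∈ Adm,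
      0 < (∏ X ∈ bfac os K t τ, Real.exp (BA (gA K) (uA K v) (pend os K t τ v) X)) * nA os K t τ v * qA os K
            * rA os K t τ v ∧
      0 < (∏ X ∈ bfac os K t τ, Real.exp (BB (gB K) (uB K v) (pend os K t τ v) X)) * nB os K t τ v * qB os K
            * rB os K t τ v ∧
      |Real.log ((∏ X ∈ bfac os K t τ, Real.exp (BB (gB K) (uB K v) (pend os K t τ v) X)) * nB os K t τ v
            * qB os K * rB os K t τ v)
          - Real.log ((∏ X ∈ bfac os K t τ, Real.exp (BA (gA K) (uA K v) (pend os K t τ v) X)) * nA os K t τ v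
            * qA os K * rA os K t τ v)
          - (cR os K t τ + (Real.log (qB os K) - Real.log (qA os K)))|
        ≤ EB₀ * (Cw * vol os) * windowSum θ' Λ (jlogOf Cl K) K + (vol os * zA os K + vol os * zB os K)
            + RR os K t τ := by
    intro os K t ht τ hτ v hv
    exact kinds_merge_pointwise (boundaryGroup_pos BA (gA K) (uA K v) (pend os K t τ v) (bfac os K t τ))
      (boundaryGroup_pos BB (gB K) (uB K v) (pend os K t τ v) (bfac os K t τ))
      (hnpos os K t ht τ hτ v hv).1 (hnpos os K t ht τ hτ v hv).2 (hq os K).1 (hq os K).2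
      (hrpos os K t ht τ hτ v hv).1 (hrpos os K t ht τ hτ v hv).2
      (boundaryKind_O (fun b hb => hURB b hb K) hEB₀ hθ'0.le (hBwin os K t ht τ hτ) (hMB os K t ht τ hτ) hv
        (hpend os K t ht τ hτ v hv))
      (hzA os K t ht τ hτ v hv) (hzB os K t ht τ hτ v hv) (hR os K t ht τ hτ v hv)
  refine hasContinuumLimit_of_rate_witness
    (oA := fun os K t τ v => (∏ X ∈ bfac os K t τ, Real.exp (BA (gA K) (uA K v) (pend os K t τ v) X))
      * nA os K t τ v * qA os K * rA os K t τ v)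
    (oB := fun os K t τ v => (∏ X ∈ bfac os K t τ, Real.exp (BB (gB K) (uB K v) (pend os K t τ v) X))
      * nB os K t τ v * qB os K * rB os K t τ v)
    (cO := fun os K t τ => cR os K t τ + (Real.log (qB os K) - Real.log (qA os K)))
    (RO := fun os K t τ => EB₀ * (Cw * vol os) * windowSum θ' Λ (jlogOf Cl K) K
      + (vol os * zA os K + vol os * zB os K) + RR os K t τ)
    (rO := fun os K => EB₀ * Cw * windowSum θ' Λ (jlogOf Cl K) K + (zA os K + zB os K) + rR os K)
    Sc hβ hm h1 hl₀ hUR hCr hθ'0 hθ'1 hθ'Λ hE ha0 ha1 hwit hvol hfmtA hfmtB hint hsc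
    (fun os K t ht τ hτ v hv => ⟨(hmerge os K t ht τ hτ v hv).1, (hmerge os K t ht τ hτ v hv).2.1⟩) hoff hS hM
    (fun os K t ht τ hτ v hv => (hmerge os K t ht τ hτ v hv).2.2) hSle (fun os K t ht τ hτ => ?_)
    (fun os => ((summable_boundaryRadius hθ'0 hθ'1 hΛ1 hCl).add ((hzAs os).add (hzBs os))).add (hrR os))
    (fun os => ?_) hW hA hB hZA hZB
  · show EB₀ * (Cw * vol os) * windowSum θ' Λ (jlogOf Cl K) K + (vol os * zA os K + vol os * zB os K)
          + RR os K t τ ≤ vol os * (EB₀ * Cw * windowSum θ' Λ (jlogOf Cl K) K + (zA os K + zB os K) + rR os K)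
    have h1 := hRR os K t ht τ hτ
    have e : vol os * (EB₀ * Cw * windowSum θ' Λ (jlogOf Cl K) K + (zA os K + zB os K) + rR os K)
        = EB₀ * (Cw * vol os) * windowSum θ' Λ (jlogOf Cl K) K + (vol os * zA os K + vol os * zB os K)
          + vol os * rR os K := by ring
    rw [e]; linarith
  · obtain ⟨c₀, s, hs, hR'⟩ := hdevR os
    refine ⟨fun K => c₀ K + (Real.log (qB os K) - Real.log (qA os K)), s, hs, fun K t ht τ hτ => ?_⟩
    show |cR os K t τ + (Real.log (qB os K) - Real.log (qA os K))
        - (c₀ K + (Real.log (qB os K) - Real.log (qA os K)))| ≤ vol os * s K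
    rw [centre_shift_sub]; exact hR' K t ht τ hτ

/-- **ALL STRINGS, END TO END, ON THE t-CURRENCY TOWERS — the term-wise route's capstone from the sibling nodes' typed
outputs with the other kinds resolved.**  As `T4TermwiseCurrency.hasContinuumLimit_of_nodes_witnessT` (node U3's
E-shapes on a t-window `Wt`, `PolyLipGrowth` of the E-Lipschitz table along run A's t-tables, NE3 + liaison, node U2's
output `InjectedRate Cd 0 θc (disc g_K g_{K+1})` AS IS, both runs' t-tables in `Wt`), PLUS node U3.B's boundary shapes on a
t-window `WB` — `NE9Fl BA WB κ ΛB` with `FadingMemory C₉B ωB ΛB`, `LipBackgroundFl BA WB κ CUB` with `PolyLipGrowth CUB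
(1/g_K²) PB qB′`, `NE5B BA BB WB κ θ₅B C₅B` (NOT PRINTED), both t-tables in `WB` — at a common rate `θ′` above
`max(ω,θc)`, `max(ωB,θc)`, `θ₅`, `θ₅B`, `θ₃` and below `1`; the per-string binders of `hasContinuumLimit_of_kinds_rate_witness`.
CONCLUSION: node U0's three targets.  HONEST FRAMING: fixed finite torus, rung (B)+1, CONDITIONAL on every binder named —
NE7 NOT PRINTED, the upstream conditionals (BetaPertH-type input behind node U2, (B), (B^μ)) inside the producers of
`hinj` / the weight half as those modules name them; nothing here is infinite volume, a mass gap, or the Clay problem.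
[folklore] -/
theorem hasContinuumLimit_of_kinds_nodesT [RegularGaugeGroup G] {σ : List O → Type} [∀ os, DecidableEq (σ os)]
    {R : Readings ι X} {Wt WB : Set (ℕ → ℝ)} {Et : Functional C.toCarriers C.BgA} {EBt : Functional C.toCarriers C.BgB}
    {θ₅ C₅ C₉ ω θc Cd C₃ θ₃ P θ₅B C₅B C₉B ωB PB : ℝ} {q qB' : ℕ} {Λm ΛB : ℕ → ℕ → ℝ}
    {CU CUB : (ℕ → ℝ) → ℕ → ℝ} {g : ℕ → ℕ → ℝ}
    {l₀ : ℝ} {vol : List O → ℝ} {K₀ : List O → ℕ} {T : (os : List O) → ℕ → Finset (σ os)}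
    {Bad : (os : List O) → ℕ → ℝ → Finset (σ os)} {A B : (os : List O) → ℕ → ℝ → σ os → ℝ}
    {μ : (os : List O) → ℕ → ℝ → σ os → Measure ι} {fac bfac : (os : List O) → ℕ → ℝ → σ os → Finset C.Dom}
    {pend : (os : List O) → ℕ → ℝ → σ os → ι → C.Fl} {nA nB rA rB : (os : List O) → ℕ → ℝ → σ os → ι → ℝ}
    {qA qB : List O → ℕ → ℝ} {κ₁ S : (os : List O) → ℕ → ℝ → σ os → ℕ → ℝ}
    {cR RR : (os : List O) → ℕ → ℝ → σ os → ℝ} {rR zA zB Wb : List O → ℕ → ℝ}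
    (Sc : TorusScheme G O) (hβ : ∀ K, 0 ≤ Sc.β K) (hm : ∀ K o, Measurable (Sc.obs K o))
    (h1 : ∀ K o U, |Sc.obs K o U| ≤ 1) (hl₀ : 0 < l₀)
    -- node U3 (E-group) on the t-window, NE3 + liaison, node U2's output
    (h9 : NE9 Et Wt κ Λm) (hΛm : FadingMemory C₉ ω Λm) (hω : 0 ≤ ω)
    (hUL : LipBackground Et Wt κ CU) (hG : PolyLipGrowth CU (fun K n => invSq (g K n)) P q) (hP : 0 ≤ P)
    (h5 : NE5 Et EBt Wt κ θ₅ C₅) (hθ₅ : 0 ≤ θ₅) (hC₅ : 0 ≤ C₅)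
    (hloc : LocalRate R C₃ θ₃) (hC₃ : 0 ≤ C₃) (hθ₃ : 0 ≤ θ₃) (hθ₃1 : θ₃ < 1) (hgd : GaugeDominated R uA uB)
    (hinj : InjectedRate Cd 0 θc (fun K j => T4CouplingMatching.disc (g K) (g (K + 1)) j)) (hCd : 0 ≤ Cd)
    (hθc : 0 ≤ θc) (htA : ∀ K, (fun n => invSq (g K n)) ∈ Wt)
    (htB : ∀ K, (fun n => invSq (g (K + 1) (n + 1))) ∈ Wt)
    (hθ' : max ω θc < θ') (hθ₅' : θ₅ ≤ θ') (hθ₃' : θ₃ ≤ θ')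
    -- node U3.B (boundary group) on its t-window
    (h9B : NE9Fl BA WB κ ΛB) (hΛB : FadingMemory C₉B ωB ΛB) (hωB : 0 ≤ ωB)
    (hULB : LipBackgroundFl BA WB κ CUB) (hGB : PolyLipGrowth CUB (fun K n => invSq (g K n)) PB qB')
    (hPB : 0 ≤ PB) (h5B : NE5B BA BB WB κ θ₅B C₅B) (hθ₅B : 0 ≤ θ₅B) (hC₅B : 0 ≤ C₅B)
    (htAB : ∀ K, (fun n => invSq (g K n)) ∈ WB) (htBB : ∀ K, (fun n => invSq (g (K + 1) (n + 1))) ∈ WB)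
    (hθ'B : max ωB θc < θ') (hθ₅B' : θ₅B ≤ θ')
    (hE : 0 ≤ E) (ha0 : 0 < a) (ha1 : a < 1) (hθ'1 : θ' < 1) (hθ'Λ : θ' ≤ Λ) (hΛ1 : 1 ≤ Λ) (hCl : 0 ≤ Cl)
    (hwit : ∀ K, ∃ v₁ ∈ R.dom, uA K v₁ = oneA ∧ uB K v₁ = oneB)
    (hvol : ∀ os, 0 < vol os)
    (hfmtA : ∀ os K t τ, A os K t τ = ∫ v, (∏ X ∈ fac os K t τ,
      Real.exp (Et (fun n => invSq (g K n)) (uA K v) X - Et (fun n => invSq (g K n)) oneA X)) *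
        ((∏ X ∈ bfac os K t τ, Real.exp (BA (fun n => invSq (g K n)) (uA K v) (pend os K t τ v) X))
          * nA os K t τ v * qA os K * rA os K t τ v) ∂(μ os K t τ))
    (hfmtB : ∀ os K t τ, B os K t τ = ∫ v, (∏ X ∈ fac os K t τ,
      Real.exp (EBt (fun n => invSq (g (K + 1) (n + 1))) (uB K v) X
        - EBt (fun n => invSq (g (K + 1) (n + 1))) oneB X)) *
        ((∏ X ∈ bfac os K t τ, Real.exp (BB (fun n => invSq (g (K + 1) (n + 1))) (uB K v) (pend os K t τ v) X))
          * nB os K t τ v * qB os K * rB os K t τ v) ∂(μ os K t τ))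
    (hint : ∀ os K t, |t| ≤ l₀ → ∀ τ ∈ T os K \ Bad os K t,
      Integrable (fun v => (∏ X ∈ fac os K t τ,
        Real.exp (Et (fun n => invSq (g K n)) (uA K v) X - Et (fun n => invSq (g K n)) oneA X)) *
        ((∏ X ∈ bfac os K t τ, Real.exp (BA (fun n => invSq (g K n)) (uA K v) (pend os K t τ v) X))
          * nA os K t τ v * qA os K * rA os K t τ v)) (μ os K t τ) ∧
      Integrable (fun v => (∏ X ∈ fac os K t τ,
        Real.exp (EBt (fun n => invSq (g (K + 1) (n + 1))) (uB K v) X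
          - EBt (fun n => invSq (g (K + 1) (n + 1))) oneB X)) *
        ((∏ X ∈ bfac os K t τ, Real.exp (BB (fun n => invSq (g (K + 1) (n + 1))) (uB K v) (pend os K t τ v) X))
          * nB os K t τ v * qB os K * rB os K t τ v)) (μ os K t τ))
    (hsc : ∀ os K t, |t| ≤ l₀ → ∀ τ ∈ T os K \ Bad os K t, ∀ X ∈ fac os K t τ, C.scale X ≤ K)
    (hoff : ∀ os K t, |t| ≤ l₀ → ∀ τ ∈ T os K \ Bad os K t, ∀ v, v ∉ R.dom →
      (∏ X ∈ fac os K t τ,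
        Real.exp (Et (fun n => invSq (g K n)) (uA K v) X - Et (fun n => invSq (g K n)) oneA X)) *
        ((∏ X ∈ bfac os K t τ, Real.exp (BA (fun n => invSq (g K n)) (uA K v) (pend os K t τ v) X))
          * nA os K t τ v * qA os K * rA os K t τ v) = 0 ∧
      (∏ X ∈ fac os K t τ,
        Real.exp (EBt (fun n => invSq (g (K + 1) (n + 1))) (uB K v) X
          - EBt (fun n => invSq (g (K + 1) (n + 1))) oneB X)) *
        ((∏ X ∈ bfac os K t τ, Real.exp (BB (fun n => invSq (g (K + 1) (n + 1))) (uB K v) (pend os K t τ v) X))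
          * nB os K t τ v * qB os K * rB os K t τ v) = 0)
    (hS : ∀ os K t, |t| ≤ l₀ → ∀ τ ∈ T os K \ Bad os K t, ∀ v ∈ R.dom, ∀ j ≤ K,
      |(∑ X ∈ fac os K t τ with C.scale X = j,
          (Real.log (Real.exp (EBt (fun n => invSq (g (K + 1) (n + 1))) (uB K v) X
              - EBt (fun n => invSq (g (K + 1) (n + 1))) oneB X))
            - Real.log (Real.exp (Et (fun n => invSq (g K n)) (uA K v) X
              - Et (fun n => invSq (g K n)) oneA X)))) - κ₁ os K t τ j| ≤ S os K t τ j)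
    (hM : ∀ os K t, |t| ≤ l₀ → ∀ τ ∈ T os K \ Bad os K t,
      Multiplicity (fac os K t τ) C.scale (fun X => Real.exp (-(κ * C.d X))) Cw (vol os) Λ K)
    (hSle : ∀ os K t, |t| ≤ l₀ → ∀ τ ∈ T os K \ Bad os K t, ∀ j ≤ K,
      S os K t τ j ≤ vol os * (E * a ^ (K - j)))
    (hpend : ∀ os K t, |t| ≤ l₀ → ∀ τ ∈ T os K \ Bad os K t, ∀ v ∈ R.dom, pend os K t τ v ∈ C.admFl)
    (hBwin : ∀ os K t, |t| ≤ l₀ → ∀ τ ∈ T os K \ Bad os K t, RecentOnly (bfac os K t τ) C.scale (jlogOf Cl K) K)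
    (hMB : ∀ os K t, |t| ≤ l₀ → ∀ τ ∈ T os K \ Bad os K t,
      Multiplicity (bfac os K t τ) C.scale (fun X => Real.exp (-(κ * C.d X))) Cw (vol os) Λ K)
    (hnpos : ∀ os K t, |t| ≤ l₀ → ∀ τ ∈ T os K \ Bad os K t, ∀ v ∈ R.dom, 0 < nA os K t τ v ∧ 0 < nB os K t τ v)
    (hzA : ∀ os K t, |t| ≤ l₀ → ∀ τ ∈ T os K \ Bad os K t, ∀ v ∈ R.dom,
      |Real.log (nA os K t τ v)| ≤ vol os * zA os K)
    (hzB : ∀ os K t, |t| ≤ l₀ → ∀ τ ∈ T os K \ Bad os K t, ∀ v ∈ R.dom,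
      |Real.log (nB os K t τ v)| ≤ vol os * zB os K)
    (hzAs : ∀ os, Summable (zA os)) (hzBs : ∀ os, Summable (zB os))
    (hq : ∀ os K, 0 < qA os K ∧ 0 < qB os K)
    (hrpos : ∀ os K t, |t| ≤ l₀ → ∀ τ ∈ T os K \ Bad os K t, ∀ v ∈ R.dom, 0 < rA os K t τ v ∧ 0 < rB os K t τ v)
    (hR : ∀ os K t, |t| ≤ l₀ → ∀ τ ∈ T os K \ Bad os K t, ∀ v ∈ R.dom,
      |Real.log (rB os K t τ v) - Real.log (rA os K t τ v) - cR os K t τ| ≤ RR os K t τ)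
    (hRR : ∀ os K t, |t| ≤ l₀ → ∀ τ ∈ T os K \ Bad os K t, RR os K t τ ≤ vol os * rR os K)
    (hrR : ∀ os, Summable (rR os))
    (hdevR : ∀ os, ∃ c₀ s : ℕ → ℝ, Summable s ∧
      ∀ K t, |t| ≤ l₀ → ∀ τ ∈ T os K \ Bad os K t, |cR os K t τ - c₀ K| ≤ vol os * s K)
    (hW : ∀ os, T4WeightBudget.RelWeightBound l₀ (T os) (A os) (B os) (Bad os) (Wb os))
    (hA : ∀ os K t, |t| ≤ l₀ → ∀ τ ∈ T os K, 0 ≤ A os K t τ)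
    (hB : ∀ os K t, |t| ≤ l₀ → ∀ τ ∈ T os K, 0 ≤ B os K t τ)
    (hZA : ∀ os K t, |t| ≤ l₀ → T4GenFunBounds.schemeZ Sc os (K₀ os + K) t = ∑ τ ∈ T os K, A os K t τ)
    (hZB : ∀ os K t, |t| ≤ l₀ → T4GenFunBounds.schemeZ Sc os (K₀ os + K + 1) t = ∑ τ ∈ T os K, B os K t τ) :
    HasContinuumLimit Sc ∧ HasUniqueLimitPoints Sc ∧ LimitPointsAgree Sc := by
  obtain ⟨a₀, ha₀, hUK⟩ := uRateUpTo_of_nodesT h9 hΛm hω hUL hG hP h5 hθ₅ hC₅ hloc hC₃ hθ₃ hθ₃1 hgd hinj hCd hθc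
    htA htB hθ' hθ₅' hθ₃'
  obtain ⟨b₀, hb₀, hUKB⟩ := uRateUpToFl_of_nodesT h9B hΛB hωB hULB hGB hPB h5B hθ₅B hC₅B hloc hC₃ hθ₃ hθ₃1 hgd hinj
    hCd hθc htAB htBB hθ'B hθ₅B' hθ₃'
  have hθ'0 : 0 < θ' := lt_of_le_of_lt (hθc.trans (le_max_right ω θc)) hθ'
  have hC₉ : 0 ≤ C₉ := T4BetaReadOut.fadingMemory_const_nonneg hΛm
  have hC₉B : 0 ≤ C₉B := T4BetaReadOut.fadingMemory_const_nonneg hΛB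
  have hCr : 0 ≤ a₀ + C₉ * Cd * (θ' / (θ' - max ω θc)) + C₅ :=
    add_nonneg (add_nonneg ha₀ (mul_nonneg (mul_nonneg hC₉ hCd) (div_nonneg hθ'0.le (sub_pos.mpr hθ').le))) hC₅
  have hEB₀ : 0 ≤ b₀ + C₉B * Cd * (θ' / (θ' - max ωB θc)) + C₅B :=
    add_nonneg (add_nonneg hb₀ (mul_nonneg (mul_nonneg hC₉B hCd) (div_nonneg hθ'0.le (sub_pos.mpr hθ'B).le))) hC₅B
  exact hasContinuumLimit_of_kinds_rate_witness (Adm := R.dom) Sc hβ hm h1 hl₀ hUK hCr hθ'0 hθ'1 hθ'Λ hΛ1 hCl hE ha0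
    ha1 hUKB hEB₀ hwit hvol hfmtA hfmtB hint hsc hoff hS hM hSle hpend hBwin hMB hnpos hzA hzB hzAs hzBs hq hrpos hR
    hRR hrR hdevR hW hA hB hZA hZB

end Scheme

/-! ## §6 Sanity: the new binders jointly inhabited, the produced radius bounding a genuine log-ratio -/

section Toy

/-- NON-VACUITY OF THE NEW BINDERS (no physics).  On the one-point boundary carrier (`T4BoundaryCarrier.trivialCarriers`:
one domain of scale `0`, one background per run, one pending field, everything admissible) take the two runs' boundary
pieces DIFFERENT and nonzero, `BA ≡ 1`, `BB ≡ 1/2`: the rate family (B-T) holds at cutoff `0` with `E₀′ = 1/2` for every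
pending field, the window binder (B-win) and the multiplicity (M-B) hold for the one boundary piece (`Cw = vol = 1`), and
the kind ledger §2–§3 — boundary group, trivial one-sided groups, constant groups `q^A = 1`, `q^B = 2`, trivial residual —
yields by `boundaryKind_O` and `kinds_merge_pointwise` the bound `1/2·windowSum θ Λ (jlogOf Cl 0) 0` on the genuine
log-ratio `|(1/2 + log 2) − 1 − log 2| = 1/2` (and `windowSum θ Λ 0 0 = 1`).  So the binder shapes consumed in §4–§5 are
jointly satisfiable with a non-trivial boundary group and the produced radius is attained. [folklore] -/
theorem toy_kinds_nonvacuous {θ Λ Cl : ℝ} (hθ : 0 ≤ θ) :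
    let C := T4BoundaryCarrier.trivialCarriers
    let BA : BFunctional C C.BgA := fun _ _ _ _ => 1
    let BB : BFunctional C C.BgB := fun _ _ _ _ => 1 / 2
    let X₀ : C.Dom := ()
    (∀ b ∈ C.admFl, URateUpTo 0 (atFl BA b) (atFl BB b) (fun _ => 1) (fun _ => 1) (fun _ : Unit => ())
        (fun _ : Unit => ()) Set.univ (1 / 2) θ 1) ∧
      RecentOnly ({X₀} : Finset C.Dom) C.scale (jlogOf Cl 0) 0 ∧
      Multiplicity ({X₀} : Finset C.Dom) C.scale (fun X => Real.exp (-(1 * C.d X))) 1 1 Λ 0 ∧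
      |Real.log ((∏ X ∈ ({X₀} : Finset C.Dom), Real.exp (BB (fun _ => 1) () () X)) * 1 * 2 * 1)
          - Real.log ((∏ X ∈ ({X₀} : Finset C.Dom), Real.exp (BA (fun _ => 1) () () X)) * 1 * 1 * 1)
          - (0 + (Real.log 2 - Real.log 1))|
        ≤ 1 / 2 * (1 * 1) * windowSum θ Λ (jlogOf Cl 0) 0 + (0 + 0) + 0 := by
  intro C BA BB X₀
  have hUR : ∀ b ∈ C.admFl, URateUpTo 0 (atFl BA b) (atFl BB b) (fun _ => 1) (fun _ => 1) (fun _ : Unit => ())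
      (fun _ : Unit => ()) Set.univ (1 / 2) θ 1 := by
    intro b _ v _ X hX
    have hX0 : C.scale X = 0 := rfl
    have hd0 : C.d X = 0 := rfl
    rw [hX0, hd0]
    norm_num [atFl, BA, BB]
  have hrec : RecentOnly ({X₀} : Finset C.Dom) C.scale (jlogOf Cl 0) 0 := by
    intro i _
    exact ⟨(jlogOf_le Cl 0).trans (le_of_eq rfl), le_of_eq rfl⟩
  have hM : Multiplicity ({X₀} : Finset C.Dom) C.scale (fun X => Real.exp (-(1 * C.d X))) 1 1 Λ 0 := by
    intro j hj
    obtain rfl : j = 0 := Nat.le_zero.mp hj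
    have hd0 : ∀ X : C.Dom, C.d X = 0 := fun _ => rfl
    have hs0 : ∀ X : C.Dom, C.scale X = 0 := fun _ => rfl
    simp [hs0, hd0]
  refine ⟨hUR, hrec, hM, ?_⟩
  have hO := boundaryKind_O (V := Unit) (pend := fun _ => ()) (v := ()) (bfac := ({X₀} : Finset C.Dom)) hUR
    (by norm_num) hθ hrec hM (Set.mem_univ _) (Set.mem_univ _)
  have hz : |Real.log (1 : ℝ)| ≤ 0 := by simp
  have hR0 : |Real.log (1 : ℝ) - Real.log 1 - 0| ≤ 0 := by simp
  have hfin := kinds_merge_pointwise (boundaryGroup_pos BA (fun _ => 1) () () {X₀})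
    (boundaryGroup_pos BB (fun _ => 1) () () {X₀}) one_pos one_pos one_pos two_pos one_pos one_pos hO hz hz hR0
  exact hfin.2.2

end Toy

end Literature.MathematicalPhysics.QuantumFieldTheory.Balaban1983to89.T4TermwiseBoundary
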